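import Literature.AlgebraicGeometry.Deformation.MorphismLiftsSquareZeroTorsorDimension
import Literature.AlgebraicGeometry.Morphisms.EtaleLiftDualNumber
import HarnessLib

/-!
# The lifts across a principal small extension are parametrised by `κ^g`, with affine-linear charts
# (SGA 1 III Prop. 5.1 ∕ Mumford §13 p. 126: «the set of all liftings is a principal homogeneous space over
# `Der(𝒪, I) ≅ T ⊗ I`», a `κ`-vector space of dimension `g`)

Layer `Literature/AlgebraicGeometry/Deformation`, namespace `Literature.AlgebraicGeometry.Deformation`.  THEOREMS ONLY (no
definition, no named fact, no instance, no notation).  Fourth panel of ★ `Deformation/MorphismLiftsSquareZeroAffine` (the torsor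
of lifts through an affine open: `existsUnique_derivation_of_lifts` ∕ `exists_lift_of_derivation`) and ★
`Deformation/MorphismLiftsSquareZeroTorsorDimension` (its dimension: `Der_{R₀}(Γ(X, V), (t₀)) ≃+ κ^g` on a standard-smooth chart
of relative dimension `g`, with the sectionwise scalar clause and `exists_derivation_mul`).  Here the two are COMPOSED into the
statement the Kodaira–Spencer count consumes ([MumfordAV1970] §13, proof of the Theorem p. 126): along a principal small extension
`q : C′ ↠ C` of LOCAL rings (`ker q = (t₀)`, `t₀ ≠ 0`, `t₀ ∈ 𝔪`, `t₀ · 𝔪 = 0`) the lifts `Spec C′ → X` over the base of a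
given `Spec C → X` are `pt v`, `v ∈ κ^g`, bijectively, and the CHARTS `ψ_v = (pt v).appLE V ⊤ ≫ ΓSpecIso C′ : Γ(X, V) → C′`
are AFFINE-LINEAR in `v`:

* §1 `eq_of_appLE_apply_eq` ∕ `appLE_apply_congr` — morphisms from an affine scheme into an affine open are determined by
  their charts (★ `eq_specMap_appLE_comp_fromSpec`), and conversely;
* §2 `ker_sq_eq_bot_of_smallExtension`, `surjective_specMap_of_smallExtension` (the kernel of a principal small extension has
  square zero; `Spec C → Spec C′` is surjective, ★ `Morphisms.surjective_specMap_of_ker_le_nilradical`) and the head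
  **`exists_lifts_parametrisation`**: for `p : X → Spec R₀`, a chart `V` (`hVg`: `s_V` standard smooth of relative dimension
  `g`) and a base lift `g₁` over `R₀` landing in `V`, `∃ pt : κ^g → (Spec C′ ⟶ X)` landing in `V` with `pt 0 = g₁`, every
  `pt v` over `R₀` and ≡ `g₁` on `Spec C`, EVERY such lift equal to `pt v` for a UNIQUE `v`, `pt` injective, and
  `ψ_{v+w} − ψ₀ = (ψ_v − ψ₀) + (ψ_w − ψ₀)`, `ψ_{c̄ • v} − ψ₀ = c · (ψ_v − ψ₀)` (pointwise, every `c ∈ C′`);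
* §3 **`exists_lifts_parametrisation_of_isAffine`** — the same over an AFFINE base `S` for `f : X → S` smooth of relative
  dimension `g` and a structure map `c′ : Spec C′ → S`, with the chart `W ∋ g₁(closed point)` CHOSEN by the theorem (★
  `exists_isStandardSmoothOfRelativeDimension_chart`, Mathlib `Scheme.preimage_eq_top_of_closedPoint_mem`; reduction along
  `S ≅ Spec Γ(S, ⊤)`, Mathlib `Scheme.isoSpec`, `Spec.preimage`).

Mathlib searched and used: `Scheme.isoSpec`, `Spec.preimage` ∕ `Spec.map_preimage`, `Scheme.preimage_eq_top_of_closedPoint_mem`,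
`smoothOfRelativeDimension_comp` (+ open immersions have relative dimension `0`), `Ideal.span_singleton_pow`,
`Ideal.span_singleton_eq_bot`, `AddEquiv.symm_apply_apply` ∕ `apply_symm_apply`, `Derivation.ext`; Mathlib has no scheme-level
torsor of lifts (the ring-level `derivationToSquareZeroOfLift` is the ★ files' input).

Cell hodgecm-mathlib (D-0151), F-3 (Mc) N3′ tower under `stub_McN3` (`Cruxes/HDel/Lines/F3DualAbelianSchemeMc.lean`), letter S-e
(Kodaira–Spencer surjectivity, lift level): this file supplies the inputs `(pt, hpt)` («infinitesimal points of `A′` parametrised by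
a `κ`-space of dimension `g`»), the lift-uniqueness half of `(hinj)`, and the sectionwise (add)∕(hom) chart relations that the cell's
`AbelianSchemes/InfinitesimalPointDifferenceSections` (J7) turns into additivity ∕ homogeneity of the difference classes, for the
cell's `AbelianSchemes/PoincareFamilyKSAssembly.exists_lift_detClassH_eq_add_of_count` (both ★-pending); count-neutral generic capital (wave-1 prover
F0P1c-p04).  HC_CM is proved only modulo the 7 printed citations until rung 0 closes; this file discharges none of them.

## References
* [SGA1] A. Grothendieck, M. Raynaud, *Revêtements étales et groupe fondamental (SGA 1)*, LNM 224 (1971) ∕ arXiv:math/0206203: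
  Exp. III §5 Prop. 5.1 (the sheaf of lifts `𝒫(g₀)` is a formally principal homogeneous space under
  `𝓗om(g₀^*Ω¹_{X/S}, 𝒥)`).
* [MumfordAV1970] D. Mumford, *Abelian Varieties* (1970), §13, proof of the Theorem, p. 126 («the set of all liftings is a
  principal homogeneous space over `Der(𝒪_{x}, I)`, … a vector space of dimension `g`»).
* [Hartshorne2010] R. Hartshorne, *Deformation Theory* (2010), §6 (small extensions, p. 50).
* [GortzWedhorn2020] U. Görtz, T. Wedhorn, *Algebraic Geometry I* (2nd ed. 2020), Cor. 2.11 and Prop. 2.12 (1) (`Spec` of a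
  surjection with nil kernel).
-/

universe u

open CategoryTheory CategoryTheory.Limits AlgebraicGeometry IsLocalRing

noncomputable section

namespace Literature.AlgebraicGeometry.Deformation

/-! ## §1 Two morphisms from an affine scheme into an affine open with the same chart coincide -/

/-- **Charts determine morphisms**: two morphisms `g, g′ : Spec B → X` landing in the affine open `V` whose charts
`g.appLE V ⊤ ≫ ΓSpecIso B` agree pointwise are EQUAL (both are `Spec` of the chart followed by `V ↪ X`, ★
`eq_specMap_appLE_comp_fromSpec`). [cite: SGA1, Exp. III §5 Prop. 5.1] -/
theorem eq_of_appLE_apply_eq {X : Scheme.{u}} {V : X.Opens} (hV : IsAffineOpen V) {B : Type u} [CommRing B]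
    (g g' : Spec (.of B) ⟶ X) (hg : g ⁻¹ᵁ V = ⊤) (hg' : g' ⁻¹ᵁ V = ⊤)
    (h : ∀ a, (g.appLE V ⊤ hg.ge ≫ (Scheme.ΓSpecIso (.of B)).hom).hom a =
      (g'.appLE V ⊤ hg'.ge ≫ (Scheme.ΓSpecIso (.of B)).hom).hom a) : g = g' := by
  have hc : g.appLE V ⊤ hg.ge ≫ (Scheme.ΓSpecIso (.of B)).hom =
      g'.appLE V ⊤ hg'.ge ≫ (Scheme.ΓSpecIso (.of B)).hom := by
    ext a
    exact h a
  exact (eq_specMap_appLE_comp_fromSpec hV g hg).trans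
    (hc ▸ (eq_specMap_appLE_comp_fromSpec hV g' hg').symm)

/-- Equal morphisms have equal charts (a `subst`-free congruence for charts carrying a proof argument).
[cite: SGA1, Exp. III §5 Prop. 5.1] -/
theorem appLE_apply_congr {X : Scheme.{u}} {V : X.Opens} {B : Type u} [CommRing B]
    {g g' : Spec (.of B) ⟶ X} (h : g = g') (hg : g ⁻¹ᵁ V = ⊤) (hg' : g' ⁻¹ᵁ V = ⊤) (a : Γ(X, V)) :
    (g.appLE V ⊤ hg.ge ≫ (Scheme.ΓSpecIso (.of B)).hom).hom a =
      (g'.appLE V ⊤ hg'.ge ≫ (Scheme.ΓSpecIso (.of B)).hom).hom a := by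
  subst h; rfl

/-! ## §2 The parametrisation of the lifts by `κ^g` -/

section Parametrisation

variable {X : Scheme.{u}} {V : X.Opens} {R₀ C' C : Type u} [CommRing R₀] [CommRing C'] [IsLocalRing C']
  [Algebra R₀ C'] [CommRing C]

/-- The kernel of a principal small extension `q : C′ ↠ C` (`ker q = (t₀)`, `t₀ ∈ 𝔪`, `t₀ · 𝔪 = 0`) has square zero.
[cite: Hartshorne2010, §6 (p. 50, small extensions)] -/
theorem ker_sq_eq_bot_of_smallExtension (q : C' →+* C) (t₀ : C') (hker : RingHom.ker q = Ideal.span {t₀})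
    (htm : ∀ m ∈ maximalIdeal C', t₀ * m = 0) (ht₀m : t₀ ∈ maximalIdeal C') :
    RingHom.ker q ^ 2 = ⊥ := by
  rw [hker, Ideal.span_singleton_pow, Ideal.span_singleton_eq_bot, pow_two]
  exact htm t₀ ht₀m

/-- `Spec C → Spec C′` is surjective for a principal small extension `q : C′ ↠ C` (the kernel is nilpotent; ★
`Morphisms.surjective_specMap_of_ker_le_nilradical`). [cite: GortzWedhorn2020, Cor. 2.11 and Prop. 2.12 (1)] -/
theorem surjective_specMap_of_smallExtension (q : C' →+* C) (hq : Function.Surjective q) (t₀ : C')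
    (hker : RingHom.ker q = Ideal.span {t₀}) (htm : ∀ m ∈ maximalIdeal C', t₀ * m = 0)
    (ht₀m : t₀ ∈ maximalIdeal C') : Surjective (Spec.map (CommRingCat.ofHom q)) :=
  Morphisms.surjective_specMap_of_ker_le_nilradical (CommRingCat.ofHom q) hq
    (Morphisms.le_nilradical_of_isNilpotent ⟨2, ker_sq_eq_bot_of_smallExtension q t₀ hker htm ht₀m⟩)

/-- **THE LIFTS ACROSS A PRINCIPAL SMALL EXTENSION ARE PARAMETRISED BY `κ^g`, WITH AFFINE-LINEAR CHARTS**
([SGA1] Exp. III Prop. 5.1 read on the affine open `Spec C′`, and [MumfordAV1970] §13 p. 126: «the set of all liftings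
is a principal homogeneous space over `Der(𝒪, I) ≅ T ⊗ I`», a `κ`-vector space of dimension `g`).  Data: `p : X → Spec R₀`
with an affine open `V` on which `p` is a standard-smooth chart of relative dimension `g` (`hVg`, for the scalar map
`s_V = ΓSpecIso⁻¹ ≫ p.appLE ⊤ V`); a LOCAL `R₀`-algebra `C′` and a principal small extension `q : C′ ↠ C`
(`ker q = (t₀)`, `t₀ ≠ 0`, `t₀ ∈ 𝔪`, `t₀ · 𝔪 = 0`); a base lift `g₁ : Spec C′ → X` over `R₀` landing in `V`.
Conclusion: there is a family `pt : κ^g → (Spec C′ ⟶ X)` (`κ = C′⁄𝔪`) of morphisms landing in `V` with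
* `pt 0 = g₁`; every `pt v` is over `R₀` and agrees with `g₁` on `Spec C`;
* EVERY `R₀`-morphism `g₂ : Spec C′ → X` agreeing with `g₁` on `Spec C` is `pt v` for a UNIQUE `v` (so `pt` is a
  bijection onto the set of lifts of `g₁|_{Spec C}`; in particular `pt` is INJECTIVE and `pt v = g₁ ↔ v = 0`);
* the CHARTS `ψ_v := (pt v).appLE V ⊤ ≫ ΓSpecIso C′ : Γ(X, V) → C′` are affine-linear in `v`:
  `ψ_{v+w} − ψ₀ = (ψ_v − ψ₀) + (ψ_w − ψ₀)` and `ψ_{c̄ • v} − ψ₀ = c · (ψ_v − ψ₀)` pointwise, for every `c ∈ C′`.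
Road: `pt := lift ∘ e⁻¹` for the additive equivalence `e : Der_{R₀}(Γ(X, V), ker q) ≃+ κ^g` of ★
`exists_addEquiv_derivation_sections_pi_residueField` and the torsor ★ `exists_lift_of_derivation` ∕
`existsUnique_derivation_of_lifts`; the scalar relation is ★ `exists_derivation_mul` + the sectionwise scalar clause of `e`.
[cite: SGA1, Exp. III §5 Prop. 5.1] [cite: MumfordAV1970, §13 (proof of the Thm. p. 126)] -/
theorem exists_lifts_parametrisation (hV : IsAffineOpen V) (p : X ⟶ Spec (.of R₀)) (g : ℕ)
    (hVg : ((Scheme.ΓSpecIso (.of R₀)).inv ≫ p.appLE ⊤ V le_top).hom.IsStandardSmoothOfRelativeDimension g)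
    (q : C' →+* C) (hq : Function.Surjective q) (t₀ : C') (ht₀ : t₀ ≠ 0)
    (hker : RingHom.ker q = Ideal.span {t₀}) (htm : ∀ m ∈ maximalIdeal C', t₀ * m = 0)
    (ht₀m : t₀ ∈ maximalIdeal C')
    (g₁ : Spec (.of C') ⟶ X) (w₁ : g₁ ≫ p = Spec.map (CommRingCat.ofHom (algebraMap R₀ C')))
    (hg₁ : g₁ ⁻¹ᵁ V = ⊤) :
    ∃ (pt : (Fin g → ResidueField C') → (Spec (.of C') ⟶ X)) (hpt : ∀ v, pt v ⁻¹ᵁ V = ⊤),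
      pt 0 = g₁ ∧
      (∀ v, pt v ≫ p = Spec.map (CommRingCat.ofHom (algebraMap R₀ C'))) ∧
      (∀ v, Spec.map (CommRingCat.ofHom q) ≫ pt v = Spec.map (CommRingCat.ofHom q) ≫ g₁) ∧
      (∀ g₂ : Spec (.of C') ⟶ X, g₂ ≫ p = Spec.map (CommRingCat.ofHom (algebraMap R₀ C')) →
        Spec.map (CommRingCat.ofHom q) ≫ g₂ = Spec.map (CommRingCat.ofHom q) ≫ g₁ → ∃! v, pt v = g₂) ∧
      (∀ v w, pt v = pt w → v = w) ∧
      (∀ v w a, ((pt (v + w)).appLE V ⊤ (hpt (v + w)).ge ≫ (Scheme.ΓSpecIso (.of C')).hom).hom a -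
          (g₁.appLE V ⊤ hg₁.ge ≫ (Scheme.ΓSpecIso (.of C')).hom).hom a =
        (((pt v).appLE V ⊤ (hpt v).ge ≫ (Scheme.ΓSpecIso (.of C')).hom).hom a -
          (g₁.appLE V ⊤ hg₁.ge ≫ (Scheme.ΓSpecIso (.of C')).hom).hom a) +
        (((pt w).appLE V ⊤ (hpt w).ge ≫ (Scheme.ΓSpecIso (.of C')).hom).hom a -
          (g₁.appLE V ⊤ hg₁.ge ≫ (Scheme.ΓSpecIso (.of C')).hom).hom a)) ∧
      (∀ (c : C') v a, ((pt (residue C' c • v)).appLE V ⊤ (hpt (residue C' c • v)).ge ≫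
            (Scheme.ΓSpecIso (.of C')).hom).hom a -
          (g₁.appLE V ⊤ hg₁.ge ≫ (Scheme.ΓSpecIso (.of C')).hom).hom a =
        c * (((pt v).appLE V ⊤ (hpt v).ge ≫ (Scheme.ΓSpecIso (.of C')).hom).hom a -
          (g₁.appLE V ⊤ hg₁.ge ≫ (Scheme.ΓSpecIso (.of C')).hom).hom a)) := by
  -- the scalar structure on `Γ(X, V)` and the base chart, as in ★ `exists_lift_of_derivation`
  set s : CommRingCat.of R₀ ⟶ Γ(X, V) := (Scheme.ΓSpecIso (.of R₀)).inv ≫ p.appLE ⊤ V le_top with hs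
  set ψ₁ : Γ(X, V) ⟶ CommRingCat.of C' := g₁.appLE V ⊤ hg₁.ge ≫ (Scheme.ΓSpecIso (.of C')).hom with hψ₁
  letI : Algebra R₀ Γ(X, V) := s.hom.toAlgebra
  letI : Algebra Γ(X, V) C' := ψ₁.hom.toAlgebra
  -- `g₁` is over `R₀`: the scalar tower `R₀ → Γ(X, V) → C'` commutes
  have e₁ : g₁ = Spec.map ψ₁ ≫ hV.fromSpec := eq_specMap_appLE_comp_fromSpec hV g₁ hg₁
  have c₁ : s ≫ ψ₁ = CommRingCat.ofHom (algebraMap R₀ C') :=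
    (comp_eq_specMap_algebraMap_iff hV p ψ₁).mp (e₁ ▸ w₁)
  haveI : IsScalarTower R₀ Γ(X, V) C' := IsScalarTower.of_algebraMap_eq fun r =>
    (congrArg (fun f : CommRingCat.of R₀ ⟶ CommRingCat.of C' => f.hom r) c₁).symm
  have hπ2 : RingHom.ker q ^ 2 = ⊥ := ker_sq_eq_bot_of_smallExtension q t₀ hker htm ht₀m
  haveI : Surjective (Spec.map (CommRingCat.ofHom q)) := surjective_specMap_of_smallExtension q hq t₀ hker htm ht₀m
  -- `Der_{R₀}(Γ(X, V), ker q) ≃+ κ^g` with its sectionwise scalar clause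
  obtain ⟨e, he⟩ := exists_addEquiv_derivation_sections_pi_residueField hV p g hVg g₁ w₁ hg₁ t₀ ht₀ htm hker
  -- the torsor: every derivation is realised by a lift
  have L := exists_lift_of_derivation p q hV hπ2 g₁ w₁ hg₁
  choose lift hliftV hlift using L
  -- the charts of the lifts
  have hchart : ∀ (δ : Derivation R₀ Γ(X, V) (RingHom.ker q)) (a : Γ(X, V)),
      ((lift δ).appLE V ⊤ (hliftV δ).ge ≫ (Scheme.ΓSpecIso (.of C')).hom).hom a = ψ₁.hom a + (δ a : C') :=
    fun δ a => (hlift δ).2.2 a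
  -- two lifts with the same derivation coordinate coincide, and the coordinate is determined by the lift
  have hcoord : ∀ (δ δ' : Derivation R₀ Γ(X, V) (RingHom.ker q)), lift δ = lift δ' → δ = δ' := by
    intro δ δ' h
    ext a
    have h3 := appLE_apply_congr h (hliftV δ) (hliftV δ') a
    rw [hchart δ a, hchart δ' a] at h3
    exact add_left_cancel h3
  refine ⟨fun v => lift (e.symm v), fun v => hliftV _, ?_, fun v => (hlift _).1, fun v => ((hlift _).2.1).symm,
    fun g₂ w₂ h₀ => ?_, fun v w hvw => e.symm.injective (hcoord _ _ hvw), fun v w a => ?_, fun c v a => ?_⟩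
  · -- `pt 0 = g₁`: the chart of `lift 0` is `ψ₁`
    refine eq_of_appLE_apply_eq hV _ _ (hliftV _) hg₁ fun a => ?_
    rw [hchart, map_zero, Derivation.zero_apply, Submodule.coe_zero, add_zero]
  · -- every lift is `pt v` for a unique `v`
    have hg₂ : g₂ ⁻¹ᵁ V = ⊤ := (preimage_eq_of_comp_eq (Spec.map (CommRingCat.ofHom q)) h₀ V).trans hg₁
    obtain ⟨δ, hδ, -⟩ := existsUnique_derivation_of_lifts p q hV hπ2 g₁ g₂ w₁ w₂ h₀.symm hg₁ hg₂
    refine ⟨e δ, ?_, fun v hv => ?_⟩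
    · -- `pt (e δ) = lift δ = g₂` (same chart)
      change lift (e.symm (e δ)) = g₂
      rw [e.symm_apply_apply]
      exact eq_of_appLE_apply_eq hV _ _ (hliftV δ) hg₂ fun a => by rw [hchart, hδ a]
    · -- uniqueness: the derivation coordinate of `g₂` is `δ`
      change lift (e.symm v) = g₂ at hv
      have hδ' : e.symm v = δ := by
        ext a
        have h1 := hchart (e.symm v) a
        rw [appLE_apply_congr hv (hliftV (e.symm v)) hg₂ a, hδ a] at h1
        exact (add_left_cancel h1).symm
      rw [← e.apply_symm_apply v, hδ']
  · -- additivity of the charts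
    change ((lift (e.symm (v + w))).appLE V ⊤ (hliftV _).ge ≫ (Scheme.ΓSpecIso (.of C')).hom).hom a - ψ₁.hom a =
      (((lift (e.symm v)).appLE V ⊤ (hliftV _).ge ≫ (Scheme.ΓSpecIso (.of C')).hom).hom a - ψ₁.hom a) +
      (((lift (e.symm w)).appLE V ⊤ (hliftV _).ge ≫ (Scheme.ΓSpecIso (.of C')).hom).hom a - ψ₁.hom a)
    rw [hchart, hchart, hchart, map_add, Derivation.add_apply, Submodule.coe_add]
    ring
  · -- homogeneity of the charts: `e.symm (c̄ • v) = c · e.symm v`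
    obtain ⟨δ', hδ'⟩ := exists_derivation_mul (RingHom.ker q) c (e.symm v)
    have hsc : e.symm (residue C' c • v) = δ' := by
      have := he c (e.symm v) δ' hδ'
      rw [e.apply_symm_apply] at this
      rw [← this, e.symm_apply_apply]
    change ((lift (e.symm (residue C' c • v))).appLE V ⊤ (hliftV _).ge ≫ (Scheme.ΓSpecIso (.of C')).hom).hom a -
        ψ₁.hom a =
      c * (((lift (e.symm v)).appLE V ⊤ (hliftV _).ge ≫ (Scheme.ΓSpecIso (.of C')).hom).hom a - ψ₁.hom a)
    rw [hchart, hchart, add_sub_cancel_left, add_sub_cancel_left]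
    have h1 : ((e.symm (residue C' c • v)) a : C') = (δ' a : C') := by rw [hsc]
    rw [h1, hδ' a]

end Parametrisation

/-! ## §3 Over an affine base, with the chart chosen through the closed point -/

section AffineBase

variable {X S : Scheme.{u}} {C' C : Type u} [CommRing C'] [IsLocalRing C'] [CommRing C]

/-- **THE PARAMETRISATION OVER AN AFFINE BASE, CHART INCLUDED** — the form consumed at an abelian scheme `A′ → S′`
(`S′` affine, `A′ → S′` smooth of relative dimension `g`, ★ `AbelianSchemeOver.isOfRelDim_iff`): for `f : X → S` smooth of
relative dimension `g` over an AFFINE `S`, a principal small extension `q : C′ ↠ C` of a local ring (`ker q = (t₀)`,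
`t₀ ≠ 0`, `t₀ ∈ 𝔪`, `t₀ · 𝔪 = 0`) with structure map `c′ : Spec C′ → S`, and a base lift `g₁ : Spec C′ → X` over `c′`,
there are an affine open `W ∋ g₁(closed point)` (a standard-smooth chart, ★ `exists_isStandardSmoothOfRelativeDimension_chart`;
every lift lands in it) and a family `pt : κ^g → (Spec C′ ⟶ X)` with `pt 0 = g₁`, all `pt v` over `c′` and ≡ `g₁` on
`Spec C`, EVERY lift of `g₁|_{Spec C}` over `c′` equal to `pt v` for a unique `v`, `pt` injective, and affine-linear charts on `W`
(`ψ_{v+w} − ψ₀ = (ψ_v − ψ₀) + (ψ_w − ψ₀)`, `ψ_{c̄•v} − ψ₀ = c · (ψ_v − ψ₀)`).  Reduction to `exists_lifts_parametrisation`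
along `S ≅ Spec Γ(S, ⊤)` (Mathlib `Scheme.isoSpec`, `Spec.preimage`). [cite: SGA1, Exp. III §5 Prop. 5.1]
[cite: MumfordAV1970, §13 (proof of the Thm. p. 126)] -/
theorem exists_lifts_parametrisation_of_isAffine [IsAffine S] (f : X ⟶ S) (g : ℕ) [SmoothOfRelativeDimension g f]
    (q : C' →+* C) (hq : Function.Surjective q) (t₀ : C') (ht₀ : t₀ ≠ 0)
    (hker : RingHom.ker q = Ideal.span {t₀}) (htm : ∀ m ∈ maximalIdeal C', t₀ * m = 0)
    (ht₀m : t₀ ∈ maximalIdeal C') (c' : Spec (.of C') ⟶ S)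
    (g₁ : Spec (.of C') ⟶ X) (w₁ : g₁ ≫ f = c') :
    ∃ (W : X.Opens) (_ : IsAffineOpen W) (hg₁ : g₁ ⁻¹ᵁ W = ⊤)
      (pt : (Fin g → ResidueField C') → (Spec (.of C') ⟶ X)) (hpt : ∀ v, pt v ⁻¹ᵁ W = ⊤),
      pt 0 = g₁ ∧
      (∀ v, pt v ≫ f = c') ∧
      (∀ v, Spec.map (CommRingCat.ofHom q) ≫ pt v = Spec.map (CommRingCat.ofHom q) ≫ g₁) ∧
      (∀ g₂ : Spec (.of C') ⟶ X, g₂ ≫ f = c' →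
        Spec.map (CommRingCat.ofHom q) ≫ g₂ = Spec.map (CommRingCat.ofHom q) ≫ g₁ → ∃! v, pt v = g₂) ∧
      (∀ v w, pt v = pt w → v = w) ∧
      (∀ v w a, ((pt (v + w)).appLE W ⊤ (hpt (v + w)).ge ≫ (Scheme.ΓSpecIso (.of C')).hom).hom a -
          (g₁.appLE W ⊤ hg₁.ge ≫ (Scheme.ΓSpecIso (.of C')).hom).hom a =
        (((pt v).appLE W ⊤ (hpt v).ge ≫ (Scheme.ΓSpecIso (.of C')).hom).hom a -
          (g₁.appLE W ⊤ hg₁.ge ≫ (Scheme.ΓSpecIso (.of C')).hom).hom a) +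
        (((pt w).appLE W ⊤ (hpt w).ge ≫ (Scheme.ΓSpecIso (.of C')).hom).hom a -
          (g₁.appLE W ⊤ hg₁.ge ≫ (Scheme.ΓSpecIso (.of C')).hom).hom a)) ∧
      (∀ (c : C') v a, ((pt (residue C' c • v)).appLE W ⊤ (hpt (residue C' c • v)).ge ≫
            (Scheme.ΓSpecIso (.of C')).hom).hom a -
          (g₁.appLE W ⊤ hg₁.ge ≫ (Scheme.ΓSpecIso (.of C')).hom).hom a =
        c * (((pt v).appLE W ⊤ (hpt v).ge ≫ (Scheme.ΓSpecIso (.of C')).hom).hom a -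
          (g₁.appLE W ⊤ hg₁.ge ≫ (Scheme.ΓSpecIso (.of C')).hom).hom a)) := by
  -- `S ≅ Spec R₀`, `R₀ := Γ(S, ⊤)`; the structure map `c′` becomes `Spec (algebraMap R₀ C′)`
  let ι : S ⟶ Spec (.of (Γ(S, ⊤) : Type u)) := S.isoSpec.hom
  haveI : IsIso ι := inferInstanceAs (IsIso S.isoSpec.hom)
  let p : X ⟶ Spec (.of (Γ(S, ⊤) : Type u)) := f ≫ ι
  let φ : CommRingCat.of (Γ(S, ⊤) : Type u) ⟶ CommRingCat.of C' := Spec.preimage (c' ≫ ι)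
  letI : Algebra (Γ(S, ⊤) : Type u) C' := φ.hom.toAlgebra
  have hφ : Spec.map (CommRingCat.ofHom (algebraMap (Γ(S, ⊤) : Type u) C')) = c' ≫ ι := by
    change Spec.map (CommRingCat.ofHom φ.hom) = _
    rw [CommRingCat.ofHom_hom, Spec.map_preimage]
  haveI : SmoothOfRelativeDimension g p := inferInstanceAs (SmoothOfRelativeDimension (g + 0) (f ≫ ι))
  have hover : ∀ g' : Spec (.of C') ⟶ X, g' ≫ f = c' ↔
      g' ≫ p = Spec.map (CommRingCat.ofHom (algebraMap (Γ(S, ⊤) : Type u) C')) := by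
    intro g'
    rw [hφ]
    change g' ≫ f = c' ↔ g' ≫ f ≫ ι = c' ≫ ι
    rw [← Category.assoc]
    exact ⟨fun h => by rw [h], fun h => (cancel_mono ι).mp h⟩
  -- the chart through the image of the closed point; every lift lands in it
  obtain ⟨W, hW, hxW, hWg⟩ := exists_isStandardSmoothOfRelativeDimension_chart p g (g₁.base (closedPoint C'))
  have hg₁ : g₁ ⁻¹ᵁ W = ⊤ := Scheme.preimage_eq_top_of_closedPoint_mem g₁ hxW
  obtain ⟨pt, hpt, h0, hp, hq', huniq, hinj, hadd, hhom⟩ :=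
    exists_lifts_parametrisation hW p g hWg q hq t₀ ht₀ hker htm ht₀m g₁ ((hover g₁).mp w₁) hg₁
  exact ⟨W, hW, hg₁, pt, hpt, h0, fun v => (hover _).mpr (hp v), hq',
    fun g₂ w₂ h₀ => huniq g₂ ((hover g₂).mp w₂) h₀, hinj, hadd, hhom⟩

end AffineBase

end Literature.AlgebraicGeometry.Deformation

end
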